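import Literature.Topology.FourManifolds.LeftHandDiscRetractionBox
import HarnessLib

/-!
# In a Milnor box the unstable set of the critical point is the plane `x⃗ = 0`
# (Milnor 1965, Def. 3.1 (2), proof of Thm. 3.12: "a straight line segment tending to the origin")

Topic `Literature/Topology/FourManifolds`; a brick for the fact seat
`provefact-Literature.Topology.FourManifolds.Cobordism.Milnor1965_exists_isolatedPair_middle`
(one-slide step of the Basis Theorem 7.6 on a slab).  In the coordinates `(x⃗, y⃗)` of Def. 3.1
(2) about a critical point `q` (`f = f(q) - |x⃗|² + |y⃗|²`, `ξ = (-x⃗, y⃗)`; the tree's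
`Literature.Topology.FourManifolds.MilnorBox`), Milnor reads the right-hand disc near `q` as the
`y⃗`-plane (Def. 3.9, proof of Thm. 3.12, PDF pp. 16–18); the proof of Thm. 7.6 (PDF p. 50)
uses it to count `D_R(p_j) · D_L(p_i) = δᵢⱼ` near the critical points.  The tree knows that a
point of the box with `|x⃗|² = 0` comes from `q` (`MilnorBox.tendsto_atBot_of_sqSumLT_eq_zero_of_mem_box`)
and that an orbit coming from `q` passes through the box with `|x⃗|² = 0` at SOME time
(`MilnorBox.exists_mem_box_sqSumLT_eq_zero_of_tendsto_atBot`).  This file proves the missing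
converse at the GIVEN point, for flows along which `f` does not decrease (gradient-like flows):

* **`MilnorBox.sqSumLT_eq_zero_of_tendsto_atBot`** — a point `y` of the box whose orbit comes
  from `q` has `|x⃗|²(y) = 0`.  (If the orbit was in the plane `x⃗ = 0` at an earlier time, it
  stays there while in the box, `forall_mem_box_of_sqSumGE_eq_zero`/`exists_exit` with the
  conservation of `|x⃗|² |y⃗|²`; a later return to the box is impossible because the orbit leaves
  through the face `|y⃗|² = 4ε²` at the value `f(q) + 4ε²`, above every value taken in the box.)
* `MilnorBox.box_inter_setOf_tendsto_atBot_eq` — hence `box ∩ W^u(q) = box ∩ {x⃗ = 0}` (with the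
  unstable set of the flow written as the set of points whose orbit tends to `q` at `-∞`);
* `MilnorBox.exists_backward_exit`, `MilnorBox.sqSumGE_eq_zero_of_tendsto_atTop`,
  `MilnorBox.box_inter_setOf_tendsto_atTop_eq` — the mirror images: a point with `|x⃗|² > 0`
  entered through the face `|x⃗|² = ε²`, and `box ∩ W^s(q) = box ∩ {y⃗ = 0}` (the left-hand disc
  near `q` is the `x⃗`-plane).

Everything is proved; no definitions, no named facts.

## References

* J. Milnor, *Lectures on the h-cobordism theorem*, notes by L. Siebenmann and J. Sondow,
  Princeton Mathematical Notes (1965), Def. 3.1 (PDF pp. 11–12), Def. 3.9 (PDF p. 16), proof of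
  Thm. 3.12 (PDF p. 18), proof of Thm. 7.6 (PDF p. 50).  Held:
  `lit read book:milnornd-lectures-h-cobordism-theorem`. [MilnorHCobordism1965]
-/

open scoped Manifold ContDiff Topology
open Set Function Filter Metric

noncomputable section

namespace Literature.Topology.FourManifolds

universe u

variable {m : ℕ} {H : Type*} [TopologicalSpace H] {J : ModelWithCorners ℝ (EuclideanSpace ℝ (Fin m)) H}
  {M : Type u} [TopologicalSpace M] [ChartedSpace H M]
  {f : M → ℝ} {X : Π x : M, TangentSpace J x} {θ : ℝ × M → M} {q : M}

namespace MilnorBox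

/-- **A point of the box whose orbit comes from the critical point lies on the plane
`x⃗ = 0`** (Milnor 1965, proof of Thm. 3.12: the trajectories of the model coming from the
origin are the straight segments of the `y⃗`-plane), for a flow along which `f` does not
decrease. [cite: MilnorHCobordism1965, proof of Thm. 3.12 (PDF p. 18), Def. 3.9 (PDF p. 16)] -/
theorem sqSumLT_eq_zero_of_tendsto_atBot [T2Space M] (D : MilnorBox J f X q) (h : IsFlowOf J X θ)
    (hmono : ∀ x, Monotone fun t => f (θ (t, x))) {y : M} (hy : y ∈ D.box)
    (hlim : Tendsto (fun t => θ (t, y)) atBot (𝓝 q)) : sqSumLT D.k (D.coord y) = 0 := by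
  have hε := D.eps_pos
  -- some point `z = θ (T₀, y)` of the orbit lies in the box on the plane `x⃗ = 0`
  obtain ⟨T₀, hz, hAz⟩ := D.exists_mem_box_sqSumLT_eq_zero_of_tendsto_atBot h hlim
  have hy_eq : y = θ (-T₀, θ (T₀, y)) := by rw [h.map_add, neg_add_cancel, h.map_zero]
  rcases le_or_gt 0 T₀ with hT₀ | hT₀
  · -- `y` is an earlier point of the orbit: backward confinement on the plane
    have hconf := D.forall_mem_box_of_sqSumLT_eq_zero h hz hAz (-T₀) (by linarith)
    rw [hy_eq]
    exact hconf.2.1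
  · -- `y` is a later point of the orbit, `y = θ (s, z)` with `s = -T₀ > 0`
    set s : ℝ := -T₀ with hs_def
    have hs : 0 < s := by simp only [hs_def]; linarith
    by_cases hBz : sqSumGE D.k (D.coord (θ (T₀, y))) = 0
    · -- `z = q`: the orbit is the constant one (forward confinement with `y⃗ = 0`)
      have hconf := D.forall_mem_box_of_sqSumGE_eq_zero h hz hBz s hs.le
      rw [hy_eq]
      rw [hconf.2.2, hAz, mul_zero]
    · have hBpos : 0 < sqSumGE D.k (D.coord (θ (T₀, y))) :=
        lt_of_le_of_ne (sqSumGE_nonneg _ _) (Ne.symm hBz)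
      -- the orbit of `z` leaves the box through the face `|y⃗|² = 4ε²`, staying on `x⃗ = 0`
      obtain ⟨T, hT0, hin, hBT, hcons⟩ := D.exists_exit h hz hBpos
      rw [hAz, zero_mul] at hcons
      have hAT : sqSumLT D.k (D.coord (θ (T, θ (T₀, y)))) = 0 := by
        have h4 : (4 : ℝ) * D.ε ^ 2 ≠ 0 := by positivity
        exact (mul_eq_zero.1 hcons).resolve_left h4
      rcases le_or_gt s T with hsT | hTs
      · -- `y` is reached before the exit: `A` decays from `0`
        have hsrc : ∀ r ∈ Icc 0 s, θ (r, θ (T₀, y)) ∈ D.chart.source :=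
          fun r hr => (hin r ⟨hr.1, hr.2.trans hsT⟩).1
        have hA := h.sqSumLT_coord_eq_exp D hs.le hsrc
        rw [h.map_zero, hAz, mul_zero] at hA
        rw [hy_eq]
        exact hA
      · -- `y` would be reached after the exit, where `f ≥ f(q) + 4ε²`: impossible in the box
        exfalso
        have hexit_val : f (θ (T, θ (T₀, y))) = f q + 4 * D.ε ^ 2 := by
          rw [D.apply_eq_of_mem_source (hin T ⟨hT0, le_rfl⟩).1, hAT, hBT]
          ring
        have hle : f (θ (T, θ (T₀, y))) ≤ f (θ (s, θ (T₀, y))) := hmono _ hTs.le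
        have hy_val : f y < f q + 4 * D.ε ^ 2 := by
          rw [D.apply_eq_of_mem_source hy.1]
          have hA0 := sqSumLT_nonneg D.k (D.coord y)
          linarith [hy.2.2]
        rw [← hy_eq] at hle
        rw [hexit_val] at hle
        exact absurd hle (not_le.2 hy_val)

/-- **In the box, the unstable set of the critical point is the plane `x⃗ = 0`**: a point of
the box has an orbit coming from `q` iff its contracting coordinates vanish (Milnor 1965,
Def. 3.9 with the proof of Thm. 3.12). [cite: MilnorHCobordism1965, Def. 3.9 (PDF p. 16), proof of Thm. 3.12 (PDF p. 18)] -/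
theorem box_inter_setOf_tendsto_atBot_eq [T2Space M] (D : MilnorBox J f X q) (h : IsFlowOf J X θ)
    (hmono : ∀ x, Monotone fun t => f (θ (t, x))) :
    D.box ∩ {y | Tendsto (fun t => θ (t, y)) atBot (𝓝 q)} =
      D.box ∩ {y | sqSumLT D.k (D.coord y) = 0} := by
  ext y
  exact ⟨fun hy => ⟨hy.1, D.sqSumLT_eq_zero_of_tendsto_atBot h hmono hy.1 hy.2⟩,
    fun hy => ⟨hy.1, D.tendsto_atBot_of_sqSumLT_eq_zero_of_mem_box h hy.1 hy.2⟩⟩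

/-! ### The dual statements: backward exit, and the stable set is the plane `y⃗ = 0` -/

/-- **The backward exit lemma.**  A point `y` of the box with `A(y) = |x⃗|²(y) > 0` entered the
box through the face `A = ε²`: there is a time `T ≥ 0` such that the orbit is in the closed box
on `[-T, 0]`, at time `-T` it is on the face `A = ε²`, and `ε² · B(θ(-T, y)) = A(y) · B(y)`
(`A B` is constant along Milnor's hyperbolas; mirror image of `MilnorBox.exists_exit`). [cite: MilnorHCobordism1965, proof of Thm. 3.12 (PDF p. 18); proof of Thm. 4.1 (PDF p. 22)] -/
theorem exists_backward_exit [T2Space M] (D : MilnorBox J f X q) (h : IsFlowOf J X θ) {y : M}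
    (hy : y ∈ D.box) (hA : 0 < sqSumLT D.k (D.coord y)) :
    ∃ T, 0 ≤ T ∧
      (∀ r ∈ Icc (-T) 0, θ (r, y) ∈ {q' | q' ∈ D.chart.source ∧ sqSumLT D.k (D.coord q') ≤ D.ε ^ 2 ∧
        sqSumGE D.k (D.coord q') ≤ 4 * D.ε ^ 2}) ∧
      sqSumLT D.k (D.coord (θ (-T, y))) = D.ε ^ 2 ∧
      D.ε ^ 2 * sqSumGE D.k (D.coord (θ (-T, y))) = sqSumLT D.k (D.coord y) * sqSumGE D.k (D.coord y) := by
  have hε := D.eps_pos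
  set B₀ := sqSumGE D.k (D.coord y) with hB₀
  set A₀ := sqSumLT D.k (D.coord y) with hA₀
  -- the orbit cannot have been in the box on `[-s*, 0]`, `s* = ε²/(2A₀)`
  set sstar : ℝ := D.ε ^ 2 / (2 * A₀) with hsstar
  have hsstar0 : 0 ≤ sstar := by positivity
  have hexit : ∃ s ∈ Icc 0 sstar, θ (-s, y) ∉ D.box := by
    by_contra hall
    push Not at hall
    have hsrc : ∀ r ∈ Icc (-sstar) 0, θ (r, y) ∈ D.chart.source := fun r hr => by
      have := (hall (-r) ⟨by linarith [hr.2], by linarith [hr.1]⟩).1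
      rwa [neg_neg] at this
    have hform := h.sqSumLT_coord_eq_exp D (by linarith : -sstar ≤ 0) hsrc
    rw [h.map_zero, zero_sub, neg_neg] at hform
    -- `A₀ = e^{-2 s*} A(θ(-s*))`, so `A(θ(-s*)) = e^{2 s*} A₀ ≥ (1 + 2 s*) A₀ = A₀ + ε²`
    have hgrow : (1 + 2 * sstar) * A₀ ≤ sqSumLT D.k (D.coord (θ (-sstar, y))) := by
      have h1 : 1 + 2 * sstar ≤ Real.exp (2 * sstar) := by
        have := Real.add_one_le_exp (2 * sstar); linarith
      have h2 : sqSumLT D.k (D.coord (θ (-sstar, y))) = Real.exp (2 * sstar) * A₀ := by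
        rw [hA₀, hform, ← mul_assoc, ← Real.exp_add, show 2 * sstar + -2 * sstar = 0 by ring,
          Real.exp_zero, one_mul]
      rw [h2]
      exact mul_le_mul_of_nonneg_right h1 hA.le
    have hcalc : (1 + 2 * sstar) * A₀ = A₀ + D.ε ^ 2 := by
      rw [hsstar]; field_simp
    have hlt : sqSumLT D.k (D.coord (θ (-sstar, y))) < D.ε ^ 2 := (hall sstar ⟨hsstar0, le_rfl⟩).2.1
    linarith
  -- the first backward exit time
  set Tset : Set ℝ := {s | s ∈ Icc 0 sstar ∧ θ (-s, y) ∉ D.box} with hTset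
  have hTne : Tset.Nonempty := by obtain ⟨s, hs, hs'⟩ := hexit; exact ⟨s, hs, hs'⟩
  have hTclosed : IsClosed Tset :=
    isClosed_Icc.inter (D.isOpen_box.isClosed_compl.preimage
      ((h.continuous_orbit y).comp continuous_neg))
  have hTbdd : BddBelow Tset := ⟨0, fun s hs => hs.1.1⟩
  set t₂ : ℝ := sInf Tset with ht₂
  have ht₂mem : t₂ ∈ Tset := hTclosed.csInf_mem hTne hTbdd
  have hin : ∀ s ∈ Ico 0 t₂, θ (-s, y) ∈ D.box := fun s hs => by
    by_contra hs'
    have hsT : s ∈ Tset := ⟨⟨hs.1, hs.2.le.trans ht₂mem.1.2⟩, hs'⟩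
    exact absurd (csInf_le hTbdd hsT) (not_le.2 hs.2)
  have ht₂pos : 0 < t₂ := by
    rcases eq_or_lt_of_le ht₂mem.1.1 with h0 | h0
    · exact absurd (by rw [← h0, neg_zero, h.map_zero]; exact hy) ht₂mem.2
    · exact h0
  have hcl := (h.apply_mem_closedBox_of_forall_mem_box D (by linarith : -t₂ < 0) fun s hs => by
    have := hin (-s) ⟨by linarith [hs.2], by linarith [hs.1]⟩
    rwa [neg_neg] at this).1
  have hsrc : ∀ r ∈ Icc (-t₂) 0, θ (r, y) ∈ D.chart.source := fun r hr => by
    rcases eq_or_lt_of_le hr.1 with h' | h'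
    · rw [← h']; exact hcl.1
    · have := (hin (-r) ⟨by linarith [hr.2], by linarith⟩).1
      rwa [neg_neg] at this
  have hA₂ := h.sqSumLT_coord_eq_exp D (by linarith : -t₂ ≤ 0) hsrc
  have hB₂ := h.sqSumGE_coord_eq_exp D (by linarith : -t₂ ≤ 0) hsrc
  rw [h.map_zero, zero_sub, neg_neg] at hA₂ hB₂
  -- `A₀ = e^{-2t₂} A(θ(-t₂))`, `B₀ = e^{2t₂} B(θ(-t₂))`
  have hA₂' : sqSumLT D.k (D.coord (θ (-t₂, y))) = Real.exp (2 * t₂) * A₀ := by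
    rw [hA₀, hA₂, ← mul_assoc, ← Real.exp_add, show 2 * t₂ + -2 * t₂ = 0 by ring,
      Real.exp_zero, one_mul]
  have hB₂' : sqSumGE D.k (D.coord (θ (-t₂, y))) = Real.exp (-2 * t₂) * B₀ := by
    rw [hB₀, hB₂, ← mul_assoc, ← Real.exp_add, show -2 * t₂ + 2 * t₂ = 0 by ring,
      Real.exp_zero, one_mul]
  -- at `-t₂`: `B < 4ε²`, so the backward exit is through `A = ε²`
  have hB₂lt : sqSumGE D.k (D.coord (θ (-t₂, y))) < 4 * D.ε ^ 2 := by
    rw [hB₂']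
    have h1 : Real.exp (-2 * t₂) ≤ 1 := Real.exp_le_one_iff.2 (by linarith)
    calc Real.exp (-2 * t₂) * B₀ ≤ 1 * B₀ := mul_le_mul_of_nonneg_right h1 (sqSumGE_nonneg _ _)
      _ < 4 * D.ε ^ 2 := by rw [one_mul]; exact hy.2.2
  have hA₂eq : sqSumLT D.k (D.coord (θ (-t₂, y))) = D.ε ^ 2 := by
    refine le_antisymm hcl.2.1 ?_
    by_contra hlt
    exact ht₂mem.2 ⟨hcl.1, not_le.1 hlt, hB₂lt⟩
  refine ⟨t₂, ht₂pos.le, fun r hr => ?_, hA₂eq, ?_⟩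
  · rcases eq_or_lt_of_le hr.1 with h' | h'
    · rw [← h']; exact hcl
    · have := hin (-r) ⟨by linarith [hr.2], by linarith⟩
      rw [neg_neg] at this
      exact D.box_subset_closedBox this
  · rw [← hA₂eq, hA₂', hB₂']
    calc Real.exp (2 * t₂) * A₀ * (Real.exp (-2 * t₂) * B₀)
        = (Real.exp (2 * t₂) * Real.exp (-2 * t₂)) * (A₀ * B₀) := by ring
      _ = A₀ * B₀ := by rw [← Real.exp_add, show 2 * t₂ + -2 * t₂ = 0 by ring, Real.exp_zero, one_mul]

/-- **A point of the box whose orbit goes to the critical point lies on the plane `y⃗ = 0`**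
(the dual of `sqSumLT_eq_zero_of_tendsto_atBot`: the left-hand disc near `q` is the
`x⃗`-plane, Milnor 1965, Def. 3.9 and proof of Thm. 3.12), for a flow along which `f` does not
decrease. [cite: MilnorHCobordism1965, proof of Thm. 3.12 (PDF p. 18), Def. 3.9 (PDF p. 16)] -/
theorem sqSumGE_eq_zero_of_tendsto_atTop [T2Space M] (D : MilnorBox J f X q) (h : IsFlowOf J X θ)
    (hmono : ∀ x, Monotone fun t => f (θ (t, x))) {y : M} (hy : y ∈ D.box)
    (hlim : Tendsto (fun t => θ (t, y)) atTop (𝓝 q)) : sqSumGE D.k (D.coord y) = 0 := by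
  have hε := D.eps_pos
  -- some point `z = θ (T₀, y)` of the orbit lies in the box on the plane `y⃗ = 0`
  obtain ⟨T₀, hz, hBz⟩ := D.exists_mem_box_sqSumGE_eq_zero_of_tendsto h hlim
  have hy_eq : y = θ (-T₀, θ (T₀, y)) := by rw [h.map_add, neg_add_cancel, h.map_zero]
  rcases le_or_gt T₀ 0 with hT₀ | hT₀
  · -- `y` is a later point of the orbit: forward confinement on the plane
    have hconf := D.forall_mem_box_of_sqSumGE_eq_zero h hz hBz (-T₀) (by linarith)
    rw [hy_eq]
    exact hconf.2.1
  · -- `y` is an earlier point of the orbit, `y = θ (-T₀, z)` with `T₀ > 0`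
    by_cases hAz : sqSumLT D.k (D.coord (θ (T₀, y))) = 0
    · -- `z = q`: backward confinement with `x⃗ = 0`
      have hconf := D.forall_mem_box_of_sqSumLT_eq_zero h hz hAz (-T₀) (by linarith)
      rw [hy_eq]
      rw [hconf.2.2, hBz, mul_zero]
    · have hApos : 0 < sqSumLT D.k (D.coord (θ (T₀, y))) :=
        lt_of_le_of_ne (sqSumLT_nonneg _ _) (Ne.symm hAz)
      -- the orbit of `z` entered the box through the face `|x⃗|² = ε²`, on `y⃗ = 0`
      obtain ⟨T, hT0, hin, hAT, hcons⟩ := D.exists_backward_exit h hz hApos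
      rw [hBz, mul_zero] at hcons
      have hBT : sqSumGE D.k (D.coord (θ (-T, θ (T₀, y)))) = 0 := by
        have h4 : D.ε ^ 2 ≠ 0 := by positivity
        exact (mul_eq_zero.1 hcons).resolve_left h4
      rcases le_or_gt T₀ T with hsT | hTs
      · -- `y` is reached after the entry: `B` was `0` already
        have hsrc : ∀ r ∈ Icc (-T₀) 0, θ (r, θ (T₀, y)) ∈ D.chart.source :=
          fun r hr => (hin r ⟨by linarith [hr.1], hr.2⟩).1
        have hB := h.sqSumGE_coord_eq_exp D (by linarith : -T₀ ≤ 0) hsrc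
        rw [h.map_zero, hBz, zero_sub, neg_neg] at hB
        -- `0 = e^{2T₀} B(θ(-T₀, z))`
        have hpos : 0 < Real.exp (2 * T₀) := Real.exp_pos _
        rw [hy_eq]
        rcases mul_eq_zero.1 hB.symm with h0 | h0
        · exact absurd h0 hpos.ne'
        · exact h0
      · -- `y` would be before the entry, where `f ≤ f(q) - ε²`: impossible in the box
        exfalso
        have hentry_val : f (θ (-T, θ (T₀, y))) = f q - D.ε ^ 2 := by
          rw [D.apply_eq_of_mem_source (hin (-T) ⟨le_rfl, by linarith⟩).1, hAT, hBT]
          ring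
        have hle : f (θ (-T₀, θ (T₀, y))) ≤ f (θ (-T, θ (T₀, y))) := hmono _ (by linarith)
        have hy_val : f q - D.ε ^ 2 < f y := by
          rw [D.apply_eq_of_mem_source hy.1]
          have hB0 := sqSumGE_nonneg D.k (D.coord y)
          linarith [hy.2.1]
        rw [← hy_eq] at hle
        rw [hentry_val] at hle
        exact absurd hle (not_le.2 hy_val)

/-- **In the box, the stable set of the critical point is the plane `y⃗ = 0`**: a point of the
box has an orbit going to `q` iff its expanding coordinates vanish. [cite: MilnorHCobordism1965, Def. 3.9 (PDF p. 16), proof of Thm. 3.12 (PDF p. 18)] -/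
theorem box_inter_setOf_tendsto_atTop_eq [T2Space M] (D : MilnorBox J f X q) (h : IsFlowOf J X θ)
    (hmono : ∀ x, Monotone fun t => f (θ (t, x))) :
    D.box ∩ {y | Tendsto (fun t => θ (t, y)) atTop (𝓝 q)} =
      D.box ∩ {y | sqSumGE D.k (D.coord y) = 0} := by
  ext y
  exact ⟨fun hy => ⟨hy.1, D.sqSumGE_eq_zero_of_tendsto_atTop h hmono hy.1 hy.2⟩,
    fun hy => ⟨hy.1, D.tendsto_atTop_of_sqSumGE_eq_zero h hy.1 hy.2⟩⟩

end MilnorBox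

end Literature.Topology.FourManifolds

end
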